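import Summits.QuantumFields.BalabanUV.Beta.EriceRemainderEnclosureHistoryAutonomyComparisonLoadBudgetLevels

/-!
# EriceRemainderEnclosureHistoryAutonomyComparisonLoadBudgetSlack — (E77d) THE SLACK FORM OF THE LEVEL-COUPLED ROW ALONG THE FLOW: at every pin `m`, for a young age `y'`
# and an older age `k` of the profile, the level ratio `(h_{m+y'}∕h_{m+k})² = a_k∕a_{y'}` times the SLACK of row `k` with respect to the ages older than `k`
# dominates the pin term plus the young's own reads on row `k` plus the in-between ages' reads weighted by THEIR level ratios —
# `(a_k∕a_{y'})·ε_k ≥ a_0∕a_{y'} + X_{y'}·S(y',k)∕y' + Σ_{y'<t<k} X_t·(a_t∕a_{y'})·S(t,k)∕t` — the hypothesis `hslack` of (E77b) `majorant_le_ratio` (with the relaxed slack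
# `c_k ≥ ε_k`) and the shape of (E77a) `ratio_mul_slack_ge`, instantiated on the flow: the saturation game of README g68∕e77 §2 majorises the chain of every box solution

Cell `pub-balaban`, β-function sub-cell, BINDER row D4 «RemainderConst leaves for Bałaban's split» (`HOME/BINDER-OWNERS.md`; owner lineage `b2b-balaban-beta-an4`;
this file by co-owner #2 lineage `b2b-balaban-beta-d4-p2`, generation 68), β-FLOW TEAM duty (1), FREEZE (0) honoured (def-free; imports (E76b) `…LoadBudgetLevels` and uses its
`load_budget_levels_at_pin`, `readWindow_nonneg`-type facts BY NAME; nothing restated).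

HONEST FRAMING (page 1, verbatim and binding).  *"Discharging BetaPertH makes Bałaban's UV stability UNCONDITIONAL — a real constructive-QFT result; it is
NOT the continuum limit and NOT the Clay problem."*  THIS FILE DISCHARGES NOTHING OF THE KIND.  Elementary real analysis about ABSTRACT functionals on a box
]0,γ]^ℕ with displayed floors, profiles and signs — hypotheses of a census, not facts; the form, signs, ages and moments of Bałaban's (1.22) limit functional
are NOT PRINTED ([I] p. 298; GAPS G-t4-U2-1∕-2) and NOT asserted.  Row D4 class UNCHANGED (critical-path width 0; instance 0∕1; D4 DISCHARGE NO DATE).  HONEST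
DEPENDENCY: continuum YM on T⁴ ⇐ BetaPertH ∧ nine spine estimates (0/9 proved); BetaPertH ⇐ (D1) ∧ (D4) ∧ CAP+tail; G-an2-4 gates asym, D1 and NE2/3/4.

THE POINT (README `HOME/b2b-balaban-beta-d4-p2/g68/e77/README.md` §2, validity step (a)).  Letters at the pin `m`: loads `X_t = L_t·t·h_{m+t}³` (`= 2x_t(m)`), level ratios
relative to the young `lev_t = (h_{m+y'}∕h_{m+t})²` (`= a_t∕a_{y'}`, `lev_{y'} = 1`, `lev_k ≥ 1` for `k ≥ y'` by (E76b) `level_ratio_ge_one`), reads `Rd(t,k) = S(t,k)∕t`,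
`S(t,k) = Σ_{l<k}√(t∕(t+l+1))`, pin term `lev₀ = (h_{m+y'}∕h_m)² > 0`.  (E76b) `load_budget_levels_at_pin` with the window `[0,k)` is `Σ_t X_t·(a_t∕a_k)·Rd(t,k) ≤ 1 − a_0∕a_k`;
multiplied by `lev_k` and split over `t = k`, `t > k`, `y' ≤ t < k` (the ages `t < y'` dropped) it is the slack form.  §1: the splitting of a sum over `range K` at an
index and above a lower index (non-negative terms dropped); §2: **`slack_form_at_pin`**.  NOT CLAIMED: anything about the static chain; anything printed.

WHAT IS PROVED ([folklore]; 0 `def`, 0 sorry).  §1 `sum_range_split_at`, `sum_filter_lt_ge_of_nonneg`.  §2 **`slack_form_at_pin`**.  §3 (append) **`game_ratio_le_level_ratio_at_pin`** ((E77b)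
`majorant_le_ratio` on the flow).  §4 (append) **`young_row_game_at_pin`**, **`next_slack_game_at_pin`**.
-/
noncomputable section
open Finset Set

namespace Summit.QuantumFields.BalabanUV.Beta.EriceRemainderEnclosureHistoryAutonomyComparisonLoadBudgetSlack

open Literature.MathematicalPhysics.QuantumFieldTheory.Balaban1983to89
open Literature.MathematicalPhysics.QuantumFieldTheory.Balaban1983to89.T4BetaStationary
open Literature.MathematicalPhysics.QuantumFieldTheory.Balaban1983to89.T4BetaFlowWellPosed
open Summit.QuantumFields.BalabanUV.Beta.EriceRemainderEnclosureHistoryAutonomyComparisonLoadBudgetLevels (load_budget_levels_at_pin readWindowIco_nonneg)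
open Summit.QuantumFields.BalabanUV.Beta.EriceRemainderEnclosureHistoryAutonomyComparisonLoadBudgetWindow (readWindow_nonneg)

/-! ## §1 Splitting a sum over `range K` -/

/-- Splitting a sum over `range K` at an index `k < K`: `Σ_{t<K} f t = f k + Σ_{t<K, k<t} f t + Σ_{t<K, t<k} f t`. [folklore] -/
theorem sum_range_split_at {K k : ℕ} (hk : k < K) (f : ℕ → ℝ) :
    ∑ t ∈ range K, f t = f k + ∑ t ∈ (range K).filter (fun t => k < t), f t + ∑ t ∈ (range K).filter (fun t => t < k), f t := by
  have h1 : ∑ t ∈ range K, f t = ∑ t ∈ (range K).filter (fun t => t < k), f t + ∑ t ∈ (range K).filter (fun t => ¬ t < k), f t :=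
    (sum_filter_add_sum_filter_not _ _ _).symm
  have h2 : ∑ t ∈ (range K).filter (fun t => ¬ t < k), f t =
      ∑ t ∈ ((range K).filter (fun t => ¬ t < k)).filter (fun t => t = k), f t +
        ∑ t ∈ ((range K).filter (fun t => ¬ t < k)).filter (fun t => ¬ t = k), f t :=
    (sum_filter_add_sum_filter_not _ _ _).symm
  have h3 : ((range K).filter (fun t => ¬ t < k)).filter (fun t => t = k) = {k} := by
    ext t
    simp only [Finset.mem_filter, Finset.mem_range, Finset.mem_singleton]
    constructor
    · rintro ⟨⟨_, _⟩, rfl⟩; rfl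
    · intro ht; subst ht; exact ⟨⟨hk, lt_irrefl _⟩, rfl⟩
  have h4 : ((range K).filter (fun t => ¬ t < k)).filter (fun t => ¬ t = k) = (range K).filter (fun t => k < t) := by
    ext t
    simp only [Finset.mem_filter, Finset.mem_range]
    constructor
    · rintro ⟨⟨htK, hnlt⟩, hne⟩; exact ⟨htK, lt_of_le_of_ne (not_lt.mp hnlt) (Ne.symm hne)⟩
    · rintro ⟨htK, hlt⟩; exact ⟨⟨htK, not_lt.mpr hlt.le⟩, (ne_of_gt hlt)⟩
  rw [h1, h2, h3, h4, sum_singleton]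
  ring

/-- Dropping the terms below a lower index from a sum of non-negative terms: for `y' < k`,
`f y' + Σ_{t<K, t<k, y'<t} f t ≤ Σ_{t<K, t<k} f t` (`f ≥ 0`, `y' < K`). [folklore] -/
theorem sum_filter_lt_ge_of_nonneg {K k y' : ℕ} (hy'k : y' < k) (hy'K : y' < K) (f : ℕ → ℝ) (hf : ∀ t, 0 ≤ f t) :
    f y' + ∑ t ∈ (range K).filter (fun t => t < k ∧ y' < t), f t ≤ ∑ t ∈ (range K).filter (fun t => t < k), f t := by
  have h1 : ∑ t ∈ (range K).filter (fun t => t < k), f t =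
      ∑ t ∈ ((range K).filter (fun t => t < k)).filter (fun t => y' ≤ t), f t +
        ∑ t ∈ ((range K).filter (fun t => t < k)).filter (fun t => ¬ y' ≤ t), f t :=
    (sum_filter_add_sum_filter_not _ _ _).symm
  have hdrop : 0 ≤ ∑ t ∈ ((range K).filter (fun t => t < k)).filter (fun t => ¬ y' ≤ t), f t := sum_nonneg fun t _ => hf t
  -- the kept part splits into `t = y'` and `y' < t`
  have h2 : ∑ t ∈ ((range K).filter (fun t => t < k)).filter (fun t => y' ≤ t), f t =
      ∑ t ∈ (((range K).filter (fun t => t < k)).filter (fun t => y' ≤ t)).filter (fun t => t = y'), f t +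
        ∑ t ∈ (((range K).filter (fun t => t < k)).filter (fun t => y' ≤ t)).filter (fun t => ¬ t = y'), f t :=
    (sum_filter_add_sum_filter_not _ _ _).symm
  have h3 : (((range K).filter (fun t => t < k)).filter (fun t => y' ≤ t)).filter (fun t => t = y') = {y'} := by
    ext t
    simp only [Finset.mem_filter, Finset.mem_range, Finset.mem_singleton]
    constructor
    · rintro ⟨⟨⟨_, _⟩, _⟩, rfl⟩; rfl
    · intro ht; subst ht; exact ⟨⟨⟨hy'K, hy'k⟩, le_rfl⟩, rfl⟩
  have h4 : (((range K).filter (fun t => t < k)).filter (fun t => y' ≤ t)).filter (fun t => ¬ t = y') =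
      (range K).filter (fun t => t < k ∧ y' < t) := by
    ext t
    simp only [Finset.mem_filter, Finset.mem_range]
    constructor
    · rintro ⟨⟨⟨htK, htk⟩, hle⟩, hne⟩; exact ⟨htK, htk, lt_of_le_of_ne hle (Ne.symm hne)⟩
    · rintro ⟨htK, htk, hlt⟩; exact ⟨⟨⟨htK, htk⟩, hlt.le⟩, ne_of_gt hlt⟩
  rw [h1, h2, h3, h4, sum_singleton]
  linarith

/-! ## §2 The slack form at every pin -/

variable {B : (ℕ → ℝ) → ℝ} {γ b : ℝ} {L : ℕ → ℝ} {K : ℕ} {h : ℕ → ℝ}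

/-- **THE SLACK FORM OF THE LEVEL-COUPLED ROW AT A PIN.**  `B` isotone with floor `b > 0`, dominated by the profile `L ≥ 0`; `h` a box solution from any pin value;
pin `m`, young age `y'`, older age `k` with `y' < k < K`.  With `X_t = L_t·t·h_{m+t}³`, `lev_t = (h_{m+y'}∕h_{m+t})²`, `Rd(t,k) = (Σ_{l<k}√(t∕(t+l+1)))∕t` and the SLACK of row `k`
with respect to its older ages `ε_k = 1 − X_k·Rd(k,k) − Σ_{k<t<K} X_t·(lev_t∕lev_k)·Rd(t,k)`:
**`lev_k·ε_k ≥ (h_{m+y'}∕h_m)² + X_{y'}·Rd(y',k) + Σ_{y'<t<k} X_t·lev_t·Rd(t,k)`** — the older age's level ratio times its slack pays the pin term, the young's own reads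
on its row and the in-between ages' reads weighted by their level ratios ((E76b) `load_budget_levels_at_pin` on the window `[0,k)`, multiplied by `lev_k`, the ages
`t < y'` dropped). [folklore] -/
theorem slack_form_at_pin (hmono : ∀ u v : ℕ → ℝ, SeqBox γ u → SeqBox γ v → (∀ j, u j ≤ v j) → B u ≤ B v)
    (hL : ∀ k, 0 ≤ L k) (hb : 0 < b) (hlo : ∀ u, SeqBox γ u → b ≤ B u) (hdom : ∀ u, SeqBox γ u → ∑ k ∈ range K, L k * u k ≤ B u)
    {gIR : ℝ} (hh : SeqBox γ h) (hf : MemFlow B gIR h) (m : ℕ) {y' k : ℕ} (hy'k : y' < k) (hkK : k < K) :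
    (h (m + y') / h m) ^ 2 + L y' * y' * h (m + y') ^ 3 * ((∑ l ∈ range k, Real.sqrt ((y' : ℝ) / ((y' : ℝ) + l + 1))) / y') +
      ∑ t ∈ (range K).filter (fun t => t < k ∧ y' < t),
        L t * t * h (m + t) ^ 3 * ((h (m + y') / h (m + t)) ^ 2 * ((∑ l ∈ range k, Real.sqrt ((t : ℝ) / ((t : ℝ) + l + 1))) / t)) ≤
    (h (m + y') / h (m + k)) ^ 2 *
      (1 - L k * k * h (m + k) ^ 3 * ((∑ l ∈ range k, Real.sqrt ((k : ℝ) / ((k : ℝ) + l + 1))) / k) -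
        ∑ t ∈ (range K).filter (fun t => k < t),
          L t * t * h (m + t) ^ 3 * (((h (m + y') / h (m + t)) ^ 2 / (h (m + y') / h (m + k)) ^ 2) *
            ((∑ l ∈ range k, Real.sqrt ((t : ℝ) / ((t : ℝ) + l + 1))) / t))) := by
  -- positivity of the trajectory
  have hp : ∀ n, 0 < h n := fun n => (hh n).1
  have hy'K : y' < K := hy'k.trans hkK
  -- the level-coupled row `k` at the pin `m`, window `[0,k)`
  have hrow := load_budget_levels_at_pin hmono hL hb hlo hdom hh hf m (Nat.zero_le k)
  simp only [← range_eq_Ico] at hrow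
  -- abbreviations
  set levk : ℝ := (h (m + y') / h (m + k)) ^ 2 with hlevk
  set F : ℕ → ℝ := fun t => L t * t * h (m + t) ^ 3 * ((h (m + k) / h (m + t)) ^ 2 *
    ((∑ l ∈ range k, Real.sqrt ((t : ℝ) / ((t : ℝ) + l + 1))) / t)) with hF
  have hlevk_pos : 0 < levk := by rw [hlevk]; exact pow_pos (div_pos (hp _) (hp _)) 2
  have hX0 : ∀ t, 0 ≤ L t * t * h (m + t) ^ 3 := fun t => mul_nonneg (mul_nonneg (hL t) (Nat.cast_nonneg t)) (pow_nonneg (hp _).le 3)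
  have hF0 : ∀ t, 0 ≤ F t := fun t => mul_nonneg (hX0 t) (mul_nonneg (sq_nonneg _) (div_nonneg (readWindow_nonneg t k) (Nat.cast_nonneg t)))
  -- split the row sum at `k` and drop the ages below `y'`
  have hsplit := sum_range_split_at hkK F
  have hlow := sum_filter_lt_ge_of_nonneg hy'k hy'K F hF0
  have hsum : F k + ∑ t ∈ (range K).filter (fun t => k < t), F t + (F y' + ∑ t ∈ (range K).filter (fun t => t < k ∧ y' < t), F t) ≤
      1 - (h (m + k) / h (m + 0)) ^ 2 := by
    have := hrow; rw [hsplit] at this; linarith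
  simp only [Nat.add_zero] at hsum
  -- multiply by `lev_k > 0`; the level factors combine: `lev_k·(h_{m+k}∕h_{m+t})² = lev_t`, `lev_k·(h_{m+k}∕h_m)² = (h_{m+y'}∕h_m)²`
  have hmul := mul_le_mul_of_nonneg_left hsum hlevk_pos.le
  have elev : ∀ t, levk * (h (m + k) / h (m + t)) ^ 2 = (h (m + y') / h (m + t)) ^ 2 := by
    intro t
    have hk0 : h (m + k) ≠ 0 := (hp _).ne'
    have ht0 : h (m + t) ≠ 0 := (hp _).ne'
    have e : h (m + y') / h (m + k) * (h (m + k) / h (m + t)) = h (m + y') / h (m + t) := by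
      field_simp
    rw [hlevk, ← mul_pow, e]
  have e0 : levk * (h (m + k) / h m) ^ 2 = (h (m + y') / h m) ^ 2 := by
    have := elev 0; simpa only [Nat.add_zero] using this
  have eFt : ∀ t, levk * F t = L t * t * h (m + t) ^ 3 * ((h (m + y') / h (m + t)) ^ 2 *
      ((∑ l ∈ range k, Real.sqrt ((t : ℝ) / ((t : ℝ) + l + 1))) / t)) := by
    intro t; rw [hF]; simp only []; rw [← elev t]; ring
  -- the own term of the young: `lev_{y'} = 1`
  have eFy : levk * F y' = L y' * y' * h (m + y') ^ 3 * ((∑ l ∈ range k, Real.sqrt ((y' : ℝ) / ((y' : ℝ) + l + 1))) / y') := by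
    rw [eFt y', div_self (hp _).ne', one_pow, one_mul]
  -- the own term of the older age: `lev_k·(h_{m+k}∕h_{m+k})² = lev_k`
  have eFk : levk * F k = levk * (L k * k * h (m + k) ^ 3 * ((∑ l ∈ range k, Real.sqrt ((k : ℝ) / ((k : ℝ) + l + 1))) / k)) := by
    rw [hF]; simp only []; rw [div_self (hp _).ne', one_pow, one_mul]
  -- older terms: `lev_t = lev_k · (lev_t∕lev_k)`
  have eFold : ∀ t, levk * F t = levk * (L t * t * h (m + t) ^ 3 * (((h (m + y') / h (m + t)) ^ 2 / levk) *
      ((∑ l ∈ range k, Real.sqrt ((t : ℝ) / ((t : ℝ) + l + 1))) / t))) := by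
    intro t; rw [eFt t]; field_simp
  -- distribute `levk` over the split sum
  have hdist : levk * (F k + ∑ t ∈ (range K).filter (fun t => k < t), F t +
      (F y' + ∑ t ∈ (range K).filter (fun t => t < k ∧ y' < t), F t)) =
      levk * F k + ∑ t ∈ (range K).filter (fun t => k < t), levk * F t +
        (levk * F y' + ∑ t ∈ (range K).filter (fun t => t < k ∧ y' < t), levk * F t) := by
    rw [mul_add, mul_add, mul_add, mul_sum, mul_sum]
  rw [hdist, mul_sub, mul_one, e0, eFy, eFk] at hmul
  rw [sum_congr rfl fun t _ => eFold t] at hmul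
  have hbtw : ∑ t ∈ (range K).filter (fun t => t < k ∧ y' < t), levk * F t =
      ∑ t ∈ (range K).filter (fun t => t < k ∧ y' < t),
        L t * t * h (m + t) ^ 3 * ((h (m + y') / h (m + t)) ^ 2 * ((∑ l ∈ range k, Real.sqrt ((t : ℝ) / ((t : ℝ) + l + 1))) / t)) :=
    sum_congr rfl fun t _ => eFt t
  rw [hbtw] at hmul
  -- collect: `lev_k·(1 − own_k − Σ_older) ≥ pin + own_{y'} + Σ_between`
  have efinal : levk * (1 - L k * k * h (m + k) ^ 3 * ((∑ l ∈ range k, Real.sqrt ((k : ℝ) / ((k : ℝ) + l + 1))) / k) -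
      ∑ t ∈ (range K).filter (fun t => k < t),
        L t * t * h (m + t) ^ 3 * (((h (m + y') / h (m + t)) ^ 2 / levk) * ((∑ l ∈ range k, Real.sqrt ((t : ℝ) / ((t : ℝ) + l + 1))) / t))) =
      levk - levk * (L k * k * h (m + k) ^ 3 * ((∑ l ∈ range k, Real.sqrt ((k : ℝ) / ((k : ℝ) + l + 1))) / k)) -
        ∑ t ∈ (range K).filter (fun t => k < t),
          levk * (L t * t * h (m + t) ^ 3 * (((h (m + y') / h (m + t)) ^ 2 / levk) * ((∑ l ∈ range k, Real.sqrt ((t : ℝ) / ((t : ℝ) + l + 1))) / t))) := by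
    rw [mul_sub, mul_sub, mul_one, mul_sum]
  rw [hlevk] at efinal hmul ⊢
  rw [efinal]
  linarith

/-! ## §3 (append, gen 68) The saturation game majorises the level ratios of the flow -/

/-- **THE GAME'S RATIOS ARE BELOW THE FLOW'S LEVEL RATIOS, AT EVERY PIN.**  Same hypotheses; pin `m`, young age `y' < K`.  Let `c_k > 0` be RELAXED SLACKS for the
older ages `y' < k < K`, i.e. upper bounds for the true slacks `ε_k = 1 − X_k Rd(k,k) − Σ_{k<t<K} X_t (lev_t∕lev_k) Rd(t,k)` of `slack_form_at_pin`, and let `ĝ` be ANY family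
obeying the game's recursion `ĝ_k ≤ max(1, (X_{y'} Rd(y',k) + Σ_{y'<t<k} X_t ĝ_t Rd(t,k))∕c_k)` (README §2; `satgame.py` takes equality).  Then **`ĝ_k ≤ lev_k = (h_{m+y'}∕h_{m+k})²`
for every `y' < k < K`** — (E77b) `majorant_le_ratio` on the flow: strong induction on `k`, using `slack_form_at_pin` (pin term dropped), `ε_k ≤ c_k`, and `lev_k ≥ 1`
(the trajectory decreases strictly, (E48a) `strictAnti_of_memFlow`).  Consequently the game's older usage, cap and next relaxed slack bound the flow's ((E77b)
`usage_ge_game_usage`, `young_row_lt_one`, `next_slack_le_relaxed` with `g := lev`). [folklore] -/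
theorem game_ratio_le_level_ratio_at_pin (hmono : ∀ u v : ℕ → ℝ, SeqBox γ u → SeqBox γ v → (∀ j, u j ≤ v j) → B u ≤ B v)
    (hL : ∀ k, 0 ≤ L k) (hb : 0 < b) (hlo : ∀ u, SeqBox γ u → b ≤ B u) (hdom : ∀ u, SeqBox γ u → ∑ k ∈ range K, L k * u k ≤ B u)
    {gIR : ℝ} (hh : SeqBox γ h) (hf : MemFlow B gIR h) (m : ℕ) {y' : ℕ} {gh c : ℕ → ℝ}
    (hcpos : ∀ k, y' < k → k < K → 0 < c k)
    (hc : ∀ k, y' < k → k < K →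
      1 - L k * k * h (m + k) ^ 3 * ((∑ l ∈ range k, Real.sqrt ((k : ℝ) / ((k : ℝ) + l + 1))) / k) -
        ∑ t ∈ (range K).filter (fun t => k < t),
          L t * t * h (m + t) ^ 3 * (((h (m + y') / h (m + t)) ^ 2 / (h (m + y') / h (m + k)) ^ 2) *
            ((∑ l ∈ range k, Real.sqrt ((t : ℝ) / ((t : ℝ) + l + 1))) / t)) ≤ c k)
    (hgh : ∀ k, y' < k → k < K → gh k ≤ max 1
      ((L y' * y' * h (m + y') ^ 3 * ((∑ l ∈ range k, Real.sqrt ((y' : ℝ) / ((y' : ℝ) + l + 1))) / y') +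
        ∑ t ∈ (range K).filter (fun t => t < k ∧ y' < t),
          L t * t * h (m + t) ^ 3 * (gh t * ((∑ l ∈ range k, Real.sqrt ((t : ℝ) / ((t : ℝ) + l + 1))) / t))) / c k)) :
    ∀ k, y' < k → k < K → gh k ≤ (h (m + y') / h (m + k)) ^ 2 := by
  have hp : ∀ n, 0 < h n := fun n => (hh n).1
  have hanti := EriceRemainderEnclosureHistoryAutonomyOrder.strictAnti_of_memFlow hb hlo hh hf
  have hX0 : ∀ t, 0 ≤ L t * t * h (m + t) ^ 3 := fun t => mul_nonneg (mul_nonneg (hL t) (Nat.cast_nonneg t)) (pow_nonneg (hp _).le 3)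
  intro k
  induction k using Nat.strong_induction_on with
  | _ k ih =>
    intro hy'k hkK
    -- `lev_k ≥ 1`
    have hlev1 : 1 ≤ (h (m + y') / h (m + k)) ^ 2 := by
      have hlt : h (m + k) < h (m + y') := hanti (by omega)
      have h1 : 1 ≤ h (m + y') / h (m + k) := by rw [le_div_iff₀ (hp _)]; linarith
      nlinarith
    have hlev0 : 0 ≤ (h (m + y') / h (m + k)) ^ 2 := sq_nonneg _
    refine (hgh k hy'k hkK).trans (max_le hlev1 ?_)
    rw [div_le_iff₀ (hcpos k hy'k hkK)]
    -- the slack form at the pin, the pin term dropped, the slack relaxed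
    have hsf := slack_form_at_pin hmono hL hb hlo hdom hh hf m hy'k hkK
    have hpin : 0 ≤ (h (m + y') / h m) ^ 2 := sq_nonneg _
    have hrel := mul_le_mul_of_nonneg_left (hc k hy'k hkK) hlev0
    -- the in-between sum is monotone in the ratios (induction hypothesis)
    have hmono' : ∑ t ∈ (range K).filter (fun t => t < k ∧ y' < t),
        L t * t * h (m + t) ^ 3 * (gh t * ((∑ l ∈ range k, Real.sqrt ((t : ℝ) / ((t : ℝ) + l + 1))) / t)) ≤
        ∑ t ∈ (range K).filter (fun t => t < k ∧ y' < t),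
          L t * t * h (m + t) ^ 3 * ((h (m + y') / h (m + t)) ^ 2 * ((∑ l ∈ range k, Real.sqrt ((t : ℝ) / ((t : ℝ) + l + 1))) / t)) := by
      refine sum_le_sum fun t ht => ?_
      have ht' := (Finset.mem_filter.mp ht).2
      have htK : t < K := Finset.mem_range.mp (Finset.mem_filter.mp ht).1
      have hght : gh t ≤ (h (m + y') / h (m + t)) ^ 2 := ih t ht'.1 ht'.2 htK
      exact mul_le_mul_of_nonneg_left (mul_le_mul_of_nonneg_right hght (div_nonneg (readWindow_nonneg t k) (Nat.cast_nonneg t))) (hX0 t)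
    linarith


/-! ## §4 (append, gen 68) The young's row and its next slack in game form, on the flow -/

/-- **THE YOUNG'S ROW IN GAME FORM, ON THE FLOW.**  In the setting of `game_ratio_le_level_ratio_at_pin` (young `y' < K`): the flow's row of the young
((E76b) `load_budget_levels_at_pin`, window `[0,y')`, pin term `> 0`, ages below `y'` dropped) and `ĝ ≤ lev` give the game's STRICT row
**`X_{y'}·Rd(y',y') + Σ_{y'<t<K} X_t·ĝ_t·Rd(t,y') < 1`** — the flow's young load is admissible in the game ((E77b) `young_row_lt_one` on the flow; with (E77a)
`load_lt_cap` it lies below the game's cap). [folklore] -/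
theorem young_row_game_at_pin (hmono : ∀ u v : ℕ → ℝ, SeqBox γ u → SeqBox γ v → (∀ j, u j ≤ v j) → B u ≤ B v)
    (hL : ∀ k, 0 ≤ L k) (hb : 0 < b) (hlo : ∀ u, SeqBox γ u → b ≤ B u) (hdom : ∀ u, SeqBox γ u → ∑ k ∈ range K, L k * u k ≤ B u)
    {gIR : ℝ} (hh : SeqBox γ h) (hf : MemFlow B gIR h) (m : ℕ) {y' : ℕ} (hy'K : y' < K) {gh c : ℕ → ℝ}
    (hcpos : ∀ k, y' < k → k < K → 0 < c k)
    (hc : ∀ k, y' < k → k < K →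
      1 - L k * k * h (m + k) ^ 3 * ((∑ l ∈ range k, Real.sqrt ((k : ℝ) / ((k : ℝ) + l + 1))) / k) -
        ∑ t ∈ (range K).filter (fun t => k < t),
          L t * t * h (m + t) ^ 3 * (((h (m + y') / h (m + t)) ^ 2 / (h (m + y') / h (m + k)) ^ 2) *
            ((∑ l ∈ range k, Real.sqrt ((t : ℝ) / ((t : ℝ) + l + 1))) / t)) ≤ c k)
    (hgh : ∀ k, y' < k → k < K → gh k ≤ max 1
      ((L y' * y' * h (m + y') ^ 3 * ((∑ l ∈ range k, Real.sqrt ((y' : ℝ) / ((y' : ℝ) + l + 1))) / y') +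
        ∑ t ∈ (range K).filter (fun t => t < k ∧ y' < t),
          L t * t * h (m + t) ^ 3 * (gh t * ((∑ l ∈ range k, Real.sqrt ((t : ℝ) / ((t : ℝ) + l + 1))) / t))) / c k)) :
    L y' * y' * h (m + y') ^ 3 * ((∑ l ∈ range y', Real.sqrt ((y' : ℝ) / ((y' : ℝ) + l + 1))) / y') +
      ∑ t ∈ (range K).filter (fun t => y' < t),
        L t * t * h (m + t) ^ 3 * (gh t * ((∑ l ∈ range y', Real.sqrt ((t : ℝ) / ((t : ℝ) + l + 1))) / t)) < 1 := by
  have hp : ∀ n, 0 < h n := fun n => (hh n).1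
  have hX0 : ∀ t, 0 ≤ L t * t * h (m + t) ^ 3 := fun t => mul_nonneg (mul_nonneg (hL t) (Nat.cast_nonneg t)) (pow_nonneg (hp _).le 3)
  have hle := game_ratio_le_level_ratio_at_pin hmono hL hb hlo hdom hh hf m hcpos hc hgh
  -- the flow's row of the young
  have hrow := load_budget_levels_at_pin hmono hL hb hlo hdom hh hf m (Nat.zero_le y')
  simp only [← range_eq_Ico, Nat.add_zero] at hrow
  set F : ℕ → ℝ := fun t => L t * t * h (m + t) ^ 3 * ((h (m + y') / h (m + t)) ^ 2 *
    ((∑ l ∈ range y', Real.sqrt ((t : ℝ) / ((t : ℝ) + l + 1))) / t)) with hF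
  have hF0 : ∀ t, 0 ≤ F t := fun t => mul_nonneg (hX0 t) (mul_nonneg (sq_nonneg _) (div_nonneg (readWindow_nonneg t y') (Nat.cast_nonneg t)))
  have hpin : 0 < (h (m + y') / h m) ^ 2 := pow_pos (div_pos (hp _) (hp _)) 2
  have hsplit := sum_range_split_at hy'K F
  have hlow : 0 ≤ ∑ t ∈ (range K).filter (fun t => t < y'), F t := sum_nonneg fun t _ => hF0 t
  have hFy : F y' = L y' * y' * h (m + y') ^ 3 * ((∑ l ∈ range y', Real.sqrt ((y' : ℝ) / ((y' : ℝ) + l + 1))) / y') := by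
    rw [hF]; simp only []; rw [div_self (hp _).ne', one_pow, one_mul]
  -- the older part is monotone in the ratios
  have hmono' : ∑ t ∈ (range K).filter (fun t => y' < t),
      L t * t * h (m + t) ^ 3 * (gh t * ((∑ l ∈ range y', Real.sqrt ((t : ℝ) / ((t : ℝ) + l + 1))) / t)) ≤
      ∑ t ∈ (range K).filter (fun t => y' < t), F t := by
    refine sum_le_sum fun t ht => ?_
    have ht' := (Finset.mem_filter.mp ht).2
    have htK : t < K := Finset.mem_range.mp (Finset.mem_filter.mp ht).1
    have hght : gh t ≤ (h (m + y') / h (m + t)) ^ 2 := hle t ht' htK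
    rw [hF]
    exact mul_le_mul_of_nonneg_left (mul_le_mul_of_nonneg_right hght (div_nonneg (readWindow_nonneg t y') (Nat.cast_nonneg t))) (hX0 t)
  have htot : F y' + ∑ t ∈ (range K).filter (fun t => y' < t), F t < 1 := by
    have := hrow; rw [hsplit] at this; linarith
  rw [hFy] at htot
  linarith

/-- **THE NEXT RELAXED SLACK DOMINATES THE NEXT TRUE SLACK, ON THE FLOW.**  The young's true slack with respect to its older ages (base `y'`, so that the level
weights are `lev_t = (h_{m+y'}∕h_{m+t})²` — for a later base `y''` the same slack appears with `(h_{m+y''}∕h_{m+t})²∕(h_{m+y''}∕h_{m+y'})² = lev_t`) is at most the game's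
`c_{y'} := 1 − X_{y'}Rd(y',y') − Σ_{y'<t<K} X_tĝ_tRd(t,y')` — so the hypothesis `ε ≤ c` of `game_ratio_le_level_ratio_at_pin` propagates to the next young ((E77b)
`next_slack_le_relaxed` on the flow). [folklore] -/
theorem next_slack_game_at_pin (hmono : ∀ u v : ℕ → ℝ, SeqBox γ u → SeqBox γ v → (∀ j, u j ≤ v j) → B u ≤ B v)
    (hL : ∀ k, 0 ≤ L k) (hb : 0 < b) (hlo : ∀ u, SeqBox γ u → b ≤ B u) (hdom : ∀ u, SeqBox γ u → ∑ k ∈ range K, L k * u k ≤ B u)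
    {gIR : ℝ} (hh : SeqBox γ h) (hf : MemFlow B gIR h) (m : ℕ) {y' : ℕ} {gh c : ℕ → ℝ}
    (hcpos : ∀ k, y' < k → k < K → 0 < c k)
    (hc : ∀ k, y' < k → k < K →
      1 - L k * k * h (m + k) ^ 3 * ((∑ l ∈ range k, Real.sqrt ((k : ℝ) / ((k : ℝ) + l + 1))) / k) -
        ∑ t ∈ (range K).filter (fun t => k < t),
          L t * t * h (m + t) ^ 3 * (((h (m + y') / h (m + t)) ^ 2 / (h (m + y') / h (m + k)) ^ 2) *
            ((∑ l ∈ range k, Real.sqrt ((t : ℝ) / ((t : ℝ) + l + 1))) / t)) ≤ c k)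
    (hgh : ∀ k, y' < k → k < K → gh k ≤ max 1
      ((L y' * y' * h (m + y') ^ 3 * ((∑ l ∈ range k, Real.sqrt ((y' : ℝ) / ((y' : ℝ) + l + 1))) / y') +
        ∑ t ∈ (range K).filter (fun t => t < k ∧ y' < t),
          L t * t * h (m + t) ^ 3 * (gh t * ((∑ l ∈ range k, Real.sqrt ((t : ℝ) / ((t : ℝ) + l + 1))) / t))) / c k)) :
    1 - L y' * y' * h (m + y') ^ 3 * ((∑ l ∈ range y', Real.sqrt ((y' : ℝ) / ((y' : ℝ) + l + 1))) / y') -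
        ∑ t ∈ (range K).filter (fun t => y' < t),
          L t * t * h (m + t) ^ 3 * ((h (m + y') / h (m + t)) ^ 2 * ((∑ l ∈ range y', Real.sqrt ((t : ℝ) / ((t : ℝ) + l + 1))) / t)) ≤
      1 - L y' * y' * h (m + y') ^ 3 * ((∑ l ∈ range y', Real.sqrt ((y' : ℝ) / ((y' : ℝ) + l + 1))) / y') -
        ∑ t ∈ (range K).filter (fun t => y' < t),
          L t * t * h (m + t) ^ 3 * (gh t * ((∑ l ∈ range y', Real.sqrt ((t : ℝ) / ((t : ℝ) + l + 1))) / t)) := by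
  have hp : ∀ n, 0 < h n := fun n => (hh n).1
  have hX0 : ∀ t, 0 ≤ L t * t * h (m + t) ^ 3 := fun t => mul_nonneg (mul_nonneg (hL t) (Nat.cast_nonneg t)) (pow_nonneg (hp _).le 3)
  have hle := game_ratio_le_level_ratio_at_pin hmono hL hb hlo hdom hh hf m hcpos hc hgh
  have hmono' : ∑ t ∈ (range K).filter (fun t => y' < t),
      L t * t * h (m + t) ^ 3 * (gh t * ((∑ l ∈ range y', Real.sqrt ((t : ℝ) / ((t : ℝ) + l + 1))) / t)) ≤
      ∑ t ∈ (range K).filter (fun t => y' < t),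
        L t * t * h (m + t) ^ 3 * ((h (m + y') / h (m + t)) ^ 2 * ((∑ l ∈ range y', Real.sqrt ((t : ℝ) / ((t : ℝ) + l + 1))) / t)) := by
    refine sum_le_sum fun t ht => ?_
    have ht' := (Finset.mem_filter.mp ht).2
    have htK : t < K := Finset.mem_range.mp (Finset.mem_filter.mp ht).1
    exact mul_le_mul_of_nonneg_left (mul_le_mul_of_nonneg_right (hle t ht' htK) (div_nonneg (readWindow_nonneg t y') (Nat.cast_nonneg t))) (hX0 t)
  linarith


end Summit.QuantumFields.BalabanUV.Beta.EriceRemainderEnclosureHistoryAutonomyComparisonLoadBudgetSlack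

end
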